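import Mathlib
import Summits.AtomisticToContinuum.HydrodynamicLimit.Theses.JaynesSqueeze
import Summits.AtomisticToContinuum.HydrodynamicLimit.Theorems.JaynesSqueezeEntropicWeakStrongHSShellC
import Summits.AtomisticToContinuum.HydrodynamicLimit.Theorems.JaynesSqueezeEntropicWeakStrongHSGammaB
import Summits.AtomisticToContinuum.HydrodynamicLimit.Theorems.JaynesSqueezeEntropicWeakStrongHSQuadB
import Summits.AtomisticToContinuum.HydrodynamicLimit.Theorems.JaynesSqueezeEntropicWeakStrongHSCoerciveB
import Summits.AtomisticToContinuum.HydrodynamicLimit.Theorems.JaynesSqueezeEntropicWeakStrongHSRegion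
import HarnessLib

/-!
# `EntropicWeakStrongHS` (stmt-AtomisticToContinuum-13461): Dafermos' relative-entropy
# stability for the hard-sphere Euler system on `𝕋³`, a-priori form — the quadratic bound of the
# relative flux and the assembly

The support item `EntropicWeakStrongHS` of route `JaynesSqueeze` is proved: under the
low-density equation of state `HsEosLowDensity` there is `η₀ > 0` such that for every classical
hard-sphere Euler solution `U` with packing `< η₀` on `[0, T)`, `t < T`, compact `K` in the
positivity/low-packing region and `ε > 0` there is `δ > 0` such that every jointly measurable
`K`-valued field `V` with global entropy `∫ h(V(s)) ≤ ∫ h(U(0)) + δ`, `‖V(0) - U(0)‖²_{L²} ≤ δ` and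
weak-form residual against the entropy variables `λ = Dh(U)` at most `δ` on `[0, t]` satisfies
`‖V(s) - U(s)‖²_{L²} ≤ ε` on `[0, t]` (Dafermos 1979; DiPerna 1979).

* `coeff_bound` — the (machine-generated) coefficients of the grouped relative flux are continuous
  functions of `(τ, x, V)` on the compact set `[0, t] × 𝕋³ × K`, hence uniformly bounded;
* `relFlux_bound` — the pointwise hypothesis of the Dafermos shell:
  `|∂ₜλ·(V - U) + Σᵢ ∂ᵢλ·(fᵢ(V) - fᵢ(U))| ≤ C₁ (h(V) - h(U) - λ·(V - U))` on `[0, t] × 𝕋³ × K`;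
* `entropicWeakStrongHS_proof` — assembly: the abstract shell (`shell`, parts A–C: Grönwall on
  `ℰ(s) ≤ 2δ + 3M√δ + C₁∫₀ˢℰ`), the bookkeeping identity `Γ ≡ 0` (`bookkeeping_identity`),
  `relFlux_bound` (from the entropy–flux compatibility identity `psi_identity`) and the coercivity
  of the relative entropy density (`coercive_constants`).
-/

noncomputable section

open Set Filter MeasureTheory Function
open scoped Topology ContDiff

namespace Summit.AtomisticToContinuum.HydrodynamicLimit.Theorems.EntropicWeakStrong

open Literature.MathematicalPhysics.KineticTheory Literature.Analysis.FunctionSpaces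

section Solution

variable {σ T η₀ : ℝ} {F : ℝ → ℝ} {ρ θ : ℝ → T3 → ℝ} {u : ℝ → T3 → V3}

/-- **Uniform bound of the coefficients of the grouped relative flux** on `[0, t] × 𝕋³ × K`
(continuity on a compact set; the left-hand side is machine-generated). -/
theorem coeff_bound (hE : IsHardSphereEulerSolution σ T ρ u θ) (hσ : 0 < σ)
    (hFa : AnalyticOnNhd ℝ F (Ioo (-η₀) η₀)) (hpack : ∀ t ∈ Ico 0 T, ∀ x, ρ t x * σ ^ 3 < η₀)
    (θo : (ℝ × V3 × ℝ) → ℝ)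
    (hθo : θo = fun U => 2 / 3 * (U.2.2 / U.1 - ‖U.2.1‖ ^ 2 / (2 * U.1 ^ 2)))
    {t : ℝ} (ht : t ∈ Ico 0 T) {K : Set (ℝ × V3 × ℝ)} (hK : IsCompact K)
    (hKΩ : K ⊆ {U : ℝ × V3 × ℝ | 0 < U.1 ∧ U.1 * σ ^ 3 < η₀ ∧ ‖U.2.1‖ ^ 2 < 2 * U.1 * U.2.2}) :
    ∃ B, 0 ≤ B ∧ ∀ τ ∈ Icc 0 t, ∀ x, ∀ V ∈ K,
      |deriv F (ρ τ x * σ ^ (3 : ℕ)) * Torus.partialDeriv 0 (u τ) x 0 * ρ τ x * σ ^ (3 : ℕ) * θ τ x ^ (2 : ℕ) + deriv F (ρ τ x * σ ^ (3 : ℕ)) * Torus.partialDeriv 1 (u τ) x 1 * ρ τ x * σ ^ (3 : ℕ) * θ τ x ^ (2 : ℕ) + deriv F (ρ τ x * σ ^ (3 : ℕ)) * Torus.partialDeriv 2 (u τ) x 2 * ρ τ x * σ ^ (3 : ℕ) * θ τ x ^ (2 : ℕ) + deriv (deriv F) (ρ τ x * σ ^ (3 : ℕ)) * Torus.partialDeriv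 0 (u τ) x 0 * ρ τ x ^ (2 : ℕ) * σ ^ (6 : ℕ) * θ τ x ^ (2 : ℕ) + deriv (deriv F) (ρ τ x * σ ^ (3 : ℕ)) * Torus.partialDeriv 1 (u τ) x 1 * ρ τ x ^ (2 : ℕ) * σ ^ (6 : ℕ) * θ τ x ^ (2 : ℕ) + deriv (deriv F) (ρ τ x * σ ^ (3 : ℕ)) * Torus.partialDeriv 2 (u τ) x 2 * ρ τ x ^ (2 : ℕ) * σ ^ (6 : ℕ) * θ τ x ^ (2 : ℕ) + deriv F (ρ τ x * σ ^ (3 : ℕ)) * ((V.1⁻¹ * V.2.1 0) - u τ x 0) * (θo V - θ τ x) * Torus.partialDeriv 0 (θ τ) x * ρ τ x * σ ^ (3 : ℕ) + deriv F (ρ τ x * σ ^ (3 : ℕ)) * ((V.1⁻¹ * V.2.1 0) - u τ x 0) * Torus.partialDeriv 0 (θ τ) x * ρ τ x * σ ^ (3 : ℕ) * θ τ x + deriv F (ρ τ x * σ ^ (3 : ℕ)) * ((V.1⁻¹ * V.2.1 1) - u τ x 1) * (θo V - θ τ x) * Torus.partialDeriv 1 (θ τ) x * ρ τ x * σ ^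 (3 : ℕ) + deriv F (ρ τ x * σ ^ (3 : ℕ)) * ((V.1⁻¹ * V.2.1 1) - u τ x 1) * Torus.partialDeriv 1 (θ τ) x * ρ τ x * σ ^ (3 : ℕ) * θ τ x + deriv F (ρ τ x * σ ^ (3 : ℕ)) * ((V.1⁻¹ * V.2.1 2) - u τ x 2) * (θo V - θ τ x) * Torus.partialDeriv 2 (θ τ) x * ρ τ x * σ ^ (3 : ℕ) + deriv F (ρ τ x * σ ^ (3 : ℕ)) * ((V.1⁻¹ * V.2.1 2) - u τ x 2) * Torus.partialDeriv 2 (θ τ) x * ρ τ x * σ ^ (3 : ℕ) * θ τ x + deriv F (ρ τ x * σ ^ (3 : ℕ)) * (θo V - θ τ x) * Torus.partialDeriv 0 (u τ) x 0 * ρ τ x * σ ^ (3 : ℕ) * θ τ x + deriv F (ρ τ x * σ ^ (3 : ℕ)) * (θo V - θ τ x) * Torus.partialDeriv 1 (u τ) x 1 * ρ τ x * σ ^ (3 : ℕ) * θ τ x + deriv F (ρ τ x * σ ^ (3 : ℕ)) * (θo V - θ τ x) * Torus.partialDeriv 2 (u τ) x 2 * ρ τ x * σ ^ (3 : ℕ)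 * θ τ x + deriv (deriv F) (ρ τ x * σ ^ (3 : ℕ)) * ((V.1⁻¹ * V.2.1 0) - u τ x 0) * (θo V - θ τ x) * Torus.partialDeriv 0 (θ τ) x * ρ τ x ^ (2 : ℕ) * σ ^ (6 : ℕ) + deriv (deriv F) (ρ τ x * σ ^ (3 : ℕ)) * ((V.1⁻¹ * V.2.1 0) - u τ x 0) * Torus.partialDeriv 0 (θ τ) x * ρ τ x ^ (2 : ℕ) * σ ^ (6 : ℕ) * θ τ x + deriv (deriv F) (ρ τ x * σ ^ (3 : ℕ)) * ((V.1⁻¹ * V.2.1 1) - u τ x 1) * (θo V - θ τ x) * Torus.partialDeriv 1 (θ τ) x * ρ τ x ^ (2 : ℕ) * σ ^ (6 : ℕ) + deriv (deriv F) (ρ τ x * σ ^ (3 : ℕ)) * ((V.1⁻¹ * V.2.1 1) - u τ x 1) * Torus.partialDeriv 1 (θ τ) x * ρ τ x ^ (2 : ℕ) * σ ^ (6 : ℕ) * θ τ x + deriv (deriv F) (ρ τ x * σ ^ (3 : ℕ)) * ((V.1⁻¹ * V.2.1 2) - u τ x 2) * (θo V - θ τ x) * Torus.partialDeriv 2 (θ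 τ) x * ρ τ x ^ (2 : ℕ) * σ ^ (6 : ℕ) + deriv (deriv F) (ρ τ x * σ ^ (3 : ℕ)) * ((V.1⁻¹ * V.2.1 2) - u τ x 2) * Torus.partialDeriv 2 (θ τ) x * ρ τ x ^ (2 : ℕ) * σ ^ (6 : ℕ) * θ τ x + deriv (deriv F) (ρ τ x * σ ^ (3 : ℕ)) * (θo V - θ τ x) * Torus.partialDeriv 0 (u τ) x 0 * ρ τ x ^ (2 : ℕ) * σ ^ (6 : ℕ) * θ τ x + deriv (deriv F) (ρ τ x * σ ^ (3 : ℕ)) * (θo V - θ τ x) * Torus.partialDeriv 1 (u τ) x 1 * ρ τ x ^ (2 : ℕ) * σ ^ (6 : ℕ) * θ τ x + deriv (deriv F) (ρ τ x * σ ^ (3 : ℕ)) * (θo V - θ τ x) * Torus.partialDeriv 2 (u τ) x 2 * ρ τ x ^ (2 : ℕ) * σ ^ (6 : ℕ) * θ τ x| +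
      |1 / 2 * ((V.1⁻¹ * V.2.1 0) - u τ x 0) ^ (2 : ℕ) * Torus.partialDeriv 0 (θ τ) x * ρ τ x + 1 / 2 * ((V.1⁻¹ * V.2.1 1) - u τ x 1) ^ (2 : ℕ) * Torus.partialDeriv 0 (θ τ) x * ρ τ x + 1 / 2 * ((V.1⁻¹ * V.2.1 2) - u τ x 2) ^ (2 : ℕ) * Torus.partialDeriv 0 (θ τ) x * ρ τ x + 5 / 2 * (θo V - θ τ x) * Torus.partialDeriv 0 (θ τ) x * ρ τ x + 1 / 2 * ((V.1⁻¹ * V.2.1 0) - u τ x 0) * ((V.1⁻¹ * V.2.1 1) - u τ x 1) * Torus.partialDeriv 1 (θ τ) x * ρ τ x + 1 / 2 * ((V.1⁻¹ * V.2.1 0) - u τ x 0) * ((V.1⁻¹ * V.2.1 2) - u τ x 2) * Torus.partialDeriv 2 (θ τ) x * ρ τ x + 2 / 3 * ((V.1⁻¹ * V.2.1 0) - u τ x 0) * Torus.partialDeriv 0 (u τ) x 0 * ρ τ x * θ τ x - 1 / 3 * ((V.1⁻¹ * V.2.1 0) - u τ x 0) * Torus.partialDeriv 1 (u τ) x 1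 * ρ τ x * θ τ x - 1 / 3 * ((V.1⁻¹ * V.2.1 0) - u τ x 0) * Torus.partialDeriv 2 (u τ) x 2 * ρ τ x * θ τ x + ((V.1⁻¹ * V.2.1 1) - u τ x 1) * Torus.partialDeriv 1 (u τ) x 0 * ρ τ x * θ τ x + ((V.1⁻¹ * V.2.1 1) - u τ x 1) * Torus.partialDeriv 0 (u τ) x 1 * ρ τ x * θ τ x + ((V.1⁻¹ * V.2.1 2) - u τ x 2) * Torus.partialDeriv 2 (u τ) x 0 * ρ τ x * θ τ x + ((V.1⁻¹ * V.2.1 2) - u τ x 2) * Torus.partialDeriv 0 (u τ) x 2 * ρ τ x * θ τ x + 2 * deriv F (ρ τ x * σ ^ (3 : ℕ)) * (θo V - θ τ x) * Torus.partialDeriv 0 (θ τ) x * ρ τ x ^ (2 : ℕ) * σ ^ (3 : ℕ) + deriv F (ρ τ x * σ ^ (3 : ℕ)) * Torus.partialDeriv 0 (θ τ) x * ρ τ x ^ (2 : ℕ) * σ ^ (3 : ℕ) * θ τ x + deriv (deriv F) (ρ τ x * σ ^ (3 : ℕ)) * (θo V - θ τ x) * Torus.partialDeriv 0 (θ τ)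 x * ρ τ x ^ (3 : ℕ) * σ ^ (6 : ℕ) + deriv (deriv F) (ρ τ x * σ ^ (3 : ℕ)) * Torus.partialDeriv 0 (θ τ) x * ρ τ x ^ (3 : ℕ) * σ ^ (6 : ℕ) * θ τ x - 1 / 3 * deriv F (ρ τ x * σ ^ (3 : ℕ)) * ((V.1⁻¹ * V.2.1 0) - u τ x 0) * Torus.partialDeriv 0 (u τ) x 0 * ρ τ x ^ (2 : ℕ) * σ ^ (3 : ℕ) * θ τ x - 1 / 3 * deriv F (ρ τ x * σ ^ (3 : ℕ)) * ((V.1⁻¹ * V.2.1 0) - u τ x 0) * Torus.partialDeriv 1 (u τ) x 1 * ρ τ x ^ (2 : ℕ) * σ ^ (3 : ℕ) * θ τ x - 1 / 3 * deriv F (ρ τ x * σ ^ (3 : ℕ)) * ((V.1⁻¹ * V.2.1 0) - u τ x 0) * Torus.partialDeriv 2 (u τ) x 2 * ρ τ x ^ (2 : ℕ) * σ ^ (3 : ℕ) * θ τ x| +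
      |1 / 2 * ((V.1⁻¹ * V.2.1 1) - u τ x 1) ^ (2 : ℕ) * Torus.partialDeriv 1 (θ τ) x * ρ τ x + 1 / 2 * ((V.1⁻¹ * V.2.1 2) - u τ x 2) ^ (2 : ℕ) * Torus.partialDeriv 1 (θ τ) x * ρ τ x + 5 / 2 * (θo V - θ τ x) * Torus.partialDeriv 1 (θ τ) x * ρ τ x + 1 / 2 * ((V.1⁻¹ * V.2.1 1) - u τ x 1) * ((V.1⁻¹ * V.2.1 2) - u τ x 2) * Torus.partialDeriv 2 (θ τ) x * ρ τ x - 1 / 3 * ((V.1⁻¹ * V.2.1 1) - u τ x 1) * Torus.partialDeriv 0 (u τ) x 0 * ρ τ x * θ τ x + 2 / 3 * ((V.1⁻¹ * V.2.1 1) - u τ x 1) * Torus.partialDeriv 1 (u τ) x 1 * ρ τ x * θ τ x - 1 / 3 * ((V.1⁻¹ * V.2.1 1) - u τ x 1) * Torus.partialDeriv 2 (u τ) x 2 * ρ τ x * θ τ x + ((V.1⁻¹ * V.2.1 2) - u τ x 2) * Torus.partialDeriv 2 (u τ) x 1 * ρ τ x * θ τ x + ((V.1⁻¹ * V.2.1 2)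 - u τ x 2) * Torus.partialDeriv 1 (u τ) x 2 * ρ τ x * θ τ x + 2 * deriv F (ρ τ x * σ ^ (3 : ℕ)) * (θo V - θ τ x) * Torus.partialDeriv 1 (θ τ) x * ρ τ x ^ (2 : ℕ) * σ ^ (3 : ℕ) + deriv F (ρ τ x * σ ^ (3 : ℕ)) * Torus.partialDeriv 1 (θ τ) x * ρ τ x ^ (2 : ℕ) * σ ^ (3 : ℕ) * θ τ x + deriv (deriv F) (ρ τ x * σ ^ (3 : ℕ)) * (θo V - θ τ x) * Torus.partialDeriv 1 (θ τ) x * ρ τ x ^ (3 : ℕ) * σ ^ (6 : ℕ) + deriv (deriv F) (ρ τ x * σ ^ (3 : ℕ)) * Torus.partialDeriv 1 (θ τ) x * ρ τ x ^ (3 : ℕ) * σ ^ (6 : ℕ) * θ τ x - 1 / 3 * deriv F (ρ τ x * σ ^ (3 : ℕ)) * ((V.1⁻¹ * V.2.1 1) - u τ x 1) * Torus.partialDeriv 0 (u τ) x 0 * ρ τ x ^ (2 : ℕ) * σ ^ (3 : ℕ) * θ τ x - 1 / 3 * deriv F (ρ τ x * σ ^ (3 : ℕ)) * ((V.1⁻¹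 * V.2.1 1) - u τ x 1) * Torus.partialDeriv 1 (u τ) x 1 * ρ τ x ^ (2 : ℕ) * σ ^ (3 : ℕ) * θ τ x - 1 / 3 * deriv F (ρ τ x * σ ^ (3 : ℕ)) * ((V.1⁻¹ * V.2.1 1) - u τ x 1) * Torus.partialDeriv 2 (u τ) x 2 * ρ τ x ^ (2 : ℕ) * σ ^ (3 : ℕ) * θ τ x| +
      |1 / 2 * ((V.1⁻¹ * V.2.1 2) - u τ x 2) ^ (2 : ℕ) * Torus.partialDeriv 2 (θ τ) x * ρ τ x + 5 / 2 * (θo V - θ τ x) * Torus.partialDeriv 2 (θ τ) x * ρ τ x - 1 / 3 * ((V.1⁻¹ * V.2.1 2) - u τ x 2) * Torus.partialDeriv 0 (u τ) x 0 * ρ τ x * θ τ x - 1 / 3 * ((V.1⁻¹ * V.2.1 2) - u τ x 2) * Torus.partialDeriv 1 (u τ) x 1 * ρ τ x * θ τ x + 2 / 3 * ((V.1⁻¹ * V.2.1 2) - u τ x 2) * Torus.partialDeriv 2 (u τ) x 2 * ρ τ x * θ τ x + 2 * deriv F (ρ τ x * σ ^ (3 : ℕ)) * (θo V - θ τ x)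 * Torus.partialDeriv 2 (θ τ) x * ρ τ x ^ (2 : ℕ) * σ ^ (3 : ℕ) + deriv F (ρ τ x * σ ^ (3 : ℕ)) * Torus.partialDeriv 2 (θ τ) x * ρ τ x ^ (2 : ℕ) * σ ^ (3 : ℕ) * θ τ x + deriv (deriv F) (ρ τ x * σ ^ (3 : ℕ)) * (θo V - θ τ x) * Torus.partialDeriv 2 (θ τ) x * ρ τ x ^ (3 : ℕ) * σ ^ (6 : ℕ) + deriv (deriv F) (ρ τ x * σ ^ (3 : ℕ)) * Torus.partialDeriv 2 (θ τ) x * ρ τ x ^ (3 : ℕ) * σ ^ (6 : ℕ) * θ τ x - 1 / 3 * deriv F (ρ τ x * σ ^ (3 : ℕ)) * ((V.1⁻¹ * V.2.1 2) - u τ x 2) * Torus.partialDeriv 0 (u τ) x 0 * ρ τ x ^ (2 : ℕ) * σ ^ (3 : ℕ) * θ τ x - 1 / 3 * deriv F (ρ τ x * σ ^ (3 : ℕ)) * ((V.1⁻¹ * V.2.1 2) - u τ x 2) * Torus.partialDeriv 1 (u τ) x 1 * ρ τ x ^ (2 : ℕ) * σ ^ (3 : ℕ) * θ τ x - 1 /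 3 * deriv F (ρ τ x * σ ^ (3 : ℕ)) * ((V.1⁻¹ * V.2.1 2) - u τ x 2) * Torus.partialDeriv 2 (u τ) x 2 * ρ τ x ^ (2 : ℕ) * σ ^ (3 : ℕ) * θ τ x| +
      |deriv F (ρ τ x * σ ^ (3 : ℕ)) * Torus.partialDeriv 0 (u τ) x 0 * ρ τ x ^ (2 : ℕ) * σ ^ (3 : ℕ) * θ τ x + deriv F (ρ τ x * σ ^ (3 : ℕ)) * Torus.partialDeriv 1 (u τ) x 1 * ρ τ x ^ (2 : ℕ) * σ ^ (3 : ℕ) * θ τ x + deriv F (ρ τ x * σ ^ (3 : ℕ)) * Torus.partialDeriv 2 (u τ) x 2 * ρ τ x ^ (2 : ℕ) * σ ^ (3 : ℕ) * θ τ x + deriv (deriv F) (ρ τ x * σ ^ (3 : ℕ)) * Torus.partialDeriv 0 (u τ) x 0 * ρ τ x ^ (3 : ℕ) * σ ^ (6 : ℕ) * θ τ x + deriv (deriv F) (ρ τ x * σ ^ (3 : ℕ)) * Torus.partialDeriv 1 (u τ) x 1 * ρ τ x ^ (3 : ℕ) * σ ^ (6 : ℕ) * θ τ x + deriv (deriv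 F) (ρ τ x * σ ^ (3 : ℕ)) * Torus.partialDeriv 2 (u τ) x 2 * ρ τ x ^ (3 : ℕ) * σ ^ (6 : ℕ) * θ τ x| +
      |1 / 2 * ((V.1⁻¹ * V.2.1 0) - u τ x 0) * Torus.partialDeriv 0 (θ τ) x * ρ τ x ^ (2 : ℕ) + 1 / 2 * ((V.1⁻¹ * V.2.1 1) - u τ x 1) * Torus.partialDeriv 1 (θ τ) x * ρ τ x ^ (2 : ℕ) + 1 / 2 * ((V.1⁻¹ * V.2.1 2) - u τ x 2) * Torus.partialDeriv 2 (θ τ) x * ρ τ x ^ (2 : ℕ) + 2 / 3 * Torus.partialDeriv 0 (u τ) x 0 * ρ τ x ^ (2 : ℕ) * θ τ x - 1 / 3 * Torus.partialDeriv 1 (u τ) x 1 * ρ τ x ^ (2 : ℕ) * θ τ x - 1 / 3 * Torus.partialDeriv 2 (u τ) x 2 * ρ τ x ^ (2 : ℕ) * θ τ x - 1 / 3 * deriv F (ρ τ x * σ ^ (3 : ℕ)) * Torus.partialDeriv 0 (u τ) x 0 * ρ τ x ^ (3 : ℕ) * σ ^ (3 : ℕ) * θ τ x - 1 / 3 * deriv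 F (ρ τ x * σ ^ (3 : ℕ)) * Torus.partialDeriv 1 (u τ) x 1 * ρ τ x ^ (3 : ℕ) * σ ^ (3 : ℕ) * θ τ x - 1 / 3 * deriv F (ρ τ x * σ ^ (3 : ℕ)) * Torus.partialDeriv 2 (u τ) x 2 * ρ τ x ^ (3 : ℕ) * σ ^ (3 : ℕ) * θ τ x| +
      |1 / 2 * ((V.1⁻¹ * V.2.1 1) - u τ x 1) * Torus.partialDeriv 0 (θ τ) x * ρ τ x ^ (2 : ℕ) + Torus.partialDeriv 1 (u τ) x 0 * ρ τ x ^ (2 : ℕ) * θ τ x + Torus.partialDeriv 0 (u τ) x 1 * ρ τ x ^ (2 : ℕ) * θ τ x| +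
      |1 / 2 * ((V.1⁻¹ * V.2.1 2) - u τ x 2) * Torus.partialDeriv 0 (θ τ) x * ρ τ x ^ (2 : ℕ) + Torus.partialDeriv 2 (u τ) x 0 * ρ τ x ^ (2 : ℕ) * θ τ x + Torus.partialDeriv 0 (u τ) x 2 * ρ τ x ^ (2 : ℕ) * θ τ x| +
      |5 / 2 * Torus.partialDeriv 0 (θ τ) x * ρ τ x ^ (2 : ℕ) + deriv F (ρ τ x * σ ^ (3 : ℕ)) * Torus.partialDeriv 0 (θ τ) x * ρ τ x ^ (3 : ℕ) * σ ^ (3 : ℕ)| +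
      |1 / 2 * ((V.1⁻¹ * V.2.1 1) - u τ x 1) * Torus.partialDeriv 1 (θ τ) x * ρ τ x ^ (2 : ℕ) + 1 / 2 * ((V.1⁻¹ * V.2.1 2) - u τ x 2) * Torus.partialDeriv 2 (θ τ) x * ρ τ x ^ (2 : ℕ) - 1 / 3 * Torus.partialDeriv 0 (u τ) x 0 * ρ τ x ^ (2 : ℕ) * θ τ x + 2 / 3 * Torus.partialDeriv 1 (u τ) x 1 * ρ τ x ^ (2 : ℕ) * θ τ x - 1 / 3 * Torus.partialDeriv 2 (u τ) x 2 * ρ τ x ^ (2 : ℕ) * θ τ x - 1 / 3 * deriv F (ρ τ x * σ ^ (3 : ℕ)) * Torus.partialDeriv 0 (u τ) x 0 * ρ τ x ^ (3 : ℕ) * σ ^ (3 : ℕ) * θ τ x - 1 / 3 * deriv F (ρ τ x * σ ^ (3 : ℕ)) * Torus.partialDeriv 1 (u τ) x 1 * ρ τ x ^ (3 : ℕ) * σ ^ (3 : ℕ) * θ τ x - 1 / 3 * deriv F (ρ τ x * σ ^ (3 : ℕ)) * Torus.partialDeriv 2 (u τ) x 2 * ρ τ x ^ (3 : ℕ) *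 σ ^ (3 : ℕ) * θ τ x| +
      |1 / 2 * ((V.1⁻¹ * V.2.1 2) - u τ x 2) * Torus.partialDeriv 1 (θ τ) x * ρ τ x ^ (2 : ℕ) + Torus.partialDeriv 2 (u τ) x 1 * ρ τ x ^ (2 : ℕ) * θ τ x + Torus.partialDeriv 1 (u τ) x 2 * ρ τ x ^ (2 : ℕ) * θ τ x| +
      |5 / 2 * Torus.partialDeriv 1 (θ τ) x * ρ τ x ^ (2 : ℕ) + deriv F (ρ τ x * σ ^ (3 : ℕ)) * Torus.partialDeriv 1 (θ τ) x * ρ τ x ^ (3 : ℕ) * σ ^ (3 : ℕ)| +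
      |1 / 2 * ((V.1⁻¹ * V.2.1 2) - u τ x 2) * Torus.partialDeriv 2 (θ τ) x * ρ τ x ^ (2 : ℕ) - 1 / 3 * Torus.partialDeriv 0 (u τ) x 0 * ρ τ x ^ (2 : ℕ) * θ τ x - 1 / 3 * Torus.partialDeriv 1 (u τ) x 1 * ρ τ x ^ (2 : ℕ) * θ τ x + 2 / 3 * Torus.partialDeriv 2 (u τ) x 2 * ρ τ x ^ (2 : ℕ) * θ τ x - 1 / 3 * deriv F (ρ τ x * σ ^ (3 : ℕ)) * Torus.partialDeriv 0 (u τ) x 0 * ρ τ x ^ (3 : ℕ) * σ ^ (3 : ℕ) * θ τ x - 1 / 3 * deriv F (ρ τ x * σ ^ (3 : ℕ)) * Torus.partialDeriv 1 (u τ) x 1 * ρ τ x ^ (3 : ℕ) * σ ^ (3 : ℕ) * θ τ x - 1 / 3 * deriv F (ρ τ x * σ ^ (3 : ℕ)) * Torus.partialDeriv 2 (u τ) x 2 * ρ τ x ^ (3 : ℕ) * σ ^ (3 : ℕ) * θ τ x| +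
      |5 / 2 * Torus.partialDeriv 2 (θ τ) x * ρ τ x ^ (2 : ℕ) + deriv F (ρ τ x * σ ^ (3 : ℕ)) * Torus.partialDeriv 2 (θ τ) x * ρ τ x ^ (3 : ℕ) * σ ^ (3 : ℕ)| +
      |Torus.partialDeriv 0 (u τ) x 0 * ρ τ x ^ (2 : ℕ) * θ τ x ^ (2 : ℕ) + Torus.partialDeriv 1 (u τ) x 1 * ρ τ x ^ (2 : ℕ) * θ τ x ^ (2 : ℕ) + Torus.partialDeriv 2 (u τ) x 2 * ρ τ x ^ (2 : ℕ) * θ τ x ^ (2 : ℕ) + (V.1 - ρ τ x) * Torus.partialDeriv 0 (u τ) x 0 * ρ τ x * θ τ x ^ (2 : ℕ) + (V.1 - ρ τ x) * Torus.partialDeriv 1 (u τ) x 1 * ρ τ x * θ τ x ^ (2 : ℕ) + (V.1 - ρ τ x) * Torus.partialDeriv 2 (u τ) x 2 * ρ τ x * θ τ x ^ (2 : ℕ) + ((V.1⁻¹ * V.2.1 0) - u τ x 0) * (θo V - θ τ x) * Torus.partialDeriv 0 (θ τ) x * ρ τ x ^ (2 : ℕ) + ((V.1⁻¹ * V.2.1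 0) - u τ x 0) * Torus.partialDeriv 0 (θ τ) x * ρ τ x ^ (2 : ℕ) * θ τ x + ((V.1⁻¹ * V.2.1 1) - u τ x 1) * (θo V - θ τ x) * Torus.partialDeriv 1 (θ τ) x * ρ τ x ^ (2 : ℕ) + ((V.1⁻¹ * V.2.1 1) - u τ x 1) * Torus.partialDeriv 1 (θ τ) x * ρ τ x ^ (2 : ℕ) * θ τ x + ((V.1⁻¹ * V.2.1 2) - u τ x 2) * (θo V - θ τ x) * Torus.partialDeriv 2 (θ τ) x * ρ τ x ^ (2 : ℕ) + ((V.1⁻¹ * V.2.1 2) - u τ x 2) * Torus.partialDeriv 2 (θ τ) x * ρ τ x ^ (2 : ℕ) * θ τ x + (θo V - θ τ x) * Torus.partialDeriv 0 (u τ) x 0 * ρ τ x ^ (2 : ℕ) * θ τ x + (θo V - θ τ x) * Torus.partialDeriv 1 (u τ) x 1 * ρ τ x ^ (2 : ℕ) * θ τ x + (θo V - θ τ x) * Torus.partialDeriv 2 (u τ) x 2 * ρ τ x ^ (2 : ℕ) * θ τ x + (V.1 - ρ τ x) * ((V.1⁻¹ * V.2.1 0) - u τ x 0) * (θo V - θ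 τ x) * Torus.partialDeriv 0 (θ τ) x * ρ τ x + (V.1 - ρ τ x) * ((V.1⁻¹ * V.2.1 0) - u τ x 0) * Torus.partialDeriv 0 (θ τ) x * ρ τ x * θ τ x + (V.1 - ρ τ x) * ((V.1⁻¹ * V.2.1 1) - u τ x 1) * (θo V - θ τ x) * Torus.partialDeriv 1 (θ τ) x * ρ τ x + (V.1 - ρ τ x) * ((V.1⁻¹ * V.2.1 1) - u τ x 1) * Torus.partialDeriv 1 (θ τ) x * ρ τ x * θ τ x + (V.1 - ρ τ x) * ((V.1⁻¹ * V.2.1 2) - u τ x 2) * (θo V - θ τ x) * Torus.partialDeriv 2 (θ τ) x * ρ τ x + (V.1 - ρ τ x) * ((V.1⁻¹ * V.2.1 2) - u τ x 2) * Torus.partialDeriv 2 (θ τ) x * ρ τ x * θ τ x + (V.1 - ρ τ x) * (θo V - θ τ x) * Torus.partialDeriv 0 (u τ) x 0 * ρ τ x * θ τ x + (V.1 - ρ τ x) * (θo V - θ τ x) * Torus.partialDeriv 1 (u τ) x 1 * ρ τ x * θ τ x + (V.1 - ρ τ x) * (θo V - θ τ x) * Torus.partialDeriv 2 (u τ) x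 2 * ρ τ x * θ τ x| ≤ B := by
  have htT : Icc 0 t ⊆ Ico 0 T := Icc_subset_Ico_right ht.2
  have hU : UniqueDiffOn ℝ (Ico (0 : ℝ) T) := uniqueDiffOn_Ico 0 T
  set S : Set ((ℝ × T3) × (ℝ × V3 × ℝ)) := (Icc 0 t ×ˢ univ) ×ˢ K with hS
  have hScpt : IsCompact S := (isCompact_Icc.prod isCompact_univ).prod hK
  have hfst : MapsTo (fun p : (ℝ × T3) × (ℝ × V3 × ℝ) => p.1) S (Icc 0 t ×ˢ univ) := fun p hp => hp.1
  have hsnd : MapsTo (fun p : (ℝ × T3) × (ℝ × V3 × ℝ) => p.2) S K := fun p hp => hp.2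
  have hK1 : ∀ V ∈ K, V.1 ≠ 0 := fun V hV => (hKΩ hV).1.ne'
  have hK1' : ∀ p ∈ S, (p : (ℝ × T3) × (ℝ × V3 × ℝ)).2.1 ≠ 0 := fun p hp => hK1 _ hp.2
  -- continuity of the classical fields and their derivatives on the slab
  have cρ0 : ContinuousOn (uncurry ρ) (Icc 0 t ×ˢ univ) :=
    hE.smooth_density.continuousOn_uncurry.mono (prod_mono htT subset_rfl)
  have cθ0 : ContinuousOn (uncurry θ) (Icc 0 t ×ˢ univ) :=
    hE.smooth_temperature.continuousOn_uncurry.mono (prod_mono htT subset_rfl)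
  have cu0 : ContinuousOn (uncurry u) (Icc 0 t ×ˢ univ) :=
    hE.smooth_velocity.continuousOn_uncurry.mono (prod_mono htT subset_rfl)
  have cdθ0 : ∀ i, ContinuousOn (uncurry fun τ => Torus.partialDeriv i (θ τ)) (Icc 0 t ×ˢ univ) :=
    fun i => (hE.smooth_temperature.partialDeriv hU i).continuousOn_uncurry.mono (prod_mono htT subset_rfl)
  have cdu0 : ∀ i, ContinuousOn (uncurry fun τ => Torus.partialDeriv i (u τ)) (Icc 0 t ×ˢ univ) :=
    fun i => (hE.smooth_velocity.partialDeriv hU i).continuousOn_uncurry.mono (prod_mono htT subset_rfl)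
  have hmaps : MapsTo (fun p : (ℝ × T3) × (ℝ × V3 × ℝ) => ρ p.1.1 p.1.2 * σ ^ 3) S (Ioo (-η₀) η₀) :=
    fun p hp => (packing_mem hE hσ hpack (htT hp.1.1) p.1.2).2
  -- the atoms as (opaque) continuous functions on `S`
  obtain ⟨fρ, hfρ⟩ : ∃ f : (ℝ × T3) × (ℝ × V3 × ℝ) → ℝ, f = fun p => ρ p.1.1 p.1.2 := ⟨_, rfl⟩
  have cfρ : ContinuousOn fρ S := by rw [hfρ]; exact cρ0.comp continuousOn_fst hfst
  obtain ⟨fθ, hfθ⟩ : ∃ f : (ℝ × T3) × (ℝ × V3 × ℝ) → ℝ, f = fun p => θ p.1.1 p.1.2 := ⟨_, rfl⟩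
  have cfθ : ContinuousOn fθ S := by rw [hfθ]; exact cθ0.comp continuousOn_fst hfst
  obtain ⟨fu0, hfu0⟩ : ∃ f : (ℝ × T3) × (ℝ × V3 × ℝ) → ℝ, f = fun p => u p.1.1 p.1.2 0 := ⟨_, rfl⟩
  have cfu0 : ContinuousOn fu0 S := by rw [hfu0]; exact (EuclideanSpace.proj (0 : Fin 3)).continuous.comp_continuousOn (cu0.comp continuousOn_fst hfst)
  obtain ⟨fu1, hfu1⟩ : ∃ f : (ℝ × T3) × (ℝ × V3 × ℝ) → ℝ, f = fun p => u p.1.1 p.1.2 1 := ⟨_, rfl⟩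
  have cfu1 : ContinuousOn fu1 S := by rw [hfu1]; exact (EuclideanSpace.proj (1 : Fin 3)).continuous.comp_continuousOn (cu0.comp continuousOn_fst hfst)
  obtain ⟨fu2, hfu2⟩ : ∃ f : (ℝ × T3) × (ℝ × V3 × ℝ) → ℝ, f = fun p => u p.1.1 p.1.2 2 := ⟨_, rfl⟩
  have cfu2 : ContinuousOn fu2 S := by rw [hfu2]; exact (EuclideanSpace.proj (2 : Fin 3)).continuous.comp_continuousOn (cu0.comp continuousOn_fst hfst)
  obtain ⟨fdθ0, hfdθ0⟩ : ∃ f : (ℝ × T3) × (ℝ × V3 × ℝ) → ℝ, f = fun p => Torus.partialDeriv 0 (θ p.1.1) p.1.2 := ⟨_, rfl⟩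
  have cfdθ0 : ContinuousOn fdθ0 S := by rw [hfdθ0]; exact (cdθ0 0).comp continuousOn_fst hfst
  obtain ⟨fdθ1, hfdθ1⟩ : ∃ f : (ℝ × T3) × (ℝ × V3 × ℝ) → ℝ, f = fun p => Torus.partialDeriv 1 (θ p.1.1) p.1.2 := ⟨_, rfl⟩
  have cfdθ1 : ContinuousOn fdθ1 S := by rw [hfdθ1]; exact (cdθ0 1).comp continuousOn_fst hfst
  obtain ⟨fdθ2, hfdθ2⟩ : ∃ f : (ℝ × T3) × (ℝ × V3 × ℝ) → ℝ, f = fun p => Torus.partialDeriv 2 (θ p.1.1) p.1.2 := ⟨_, rfl⟩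
  have cfdθ2 : ContinuousOn fdθ2 S := by rw [hfdθ2]; exact (cdθ0 2).comp continuousOn_fst hfst
  obtain ⟨fdu00, hfdu00⟩ : ∃ f : (ℝ × T3) × (ℝ × V3 × ℝ) → ℝ, f = fun p => Torus.partialDeriv 0 (u p.1.1) p.1.2 0 := ⟨_, rfl⟩
  have cfdu00 : ContinuousOn fdu00 S := by rw [hfdu00]; exact (EuclideanSpace.proj (0 : Fin 3)).continuous.comp_continuousOn ((cdu0 0).comp continuousOn_fst hfst)
  obtain ⟨fdu01, hfdu01⟩ : ∃ f : (ℝ × T3) × (ℝ × V3 × ℝ) → ℝ, f = fun p => Torus.partialDeriv 1 (u p.1.1) p.1.2 0 := ⟨_, rfl⟩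
  have cfdu01 : ContinuousOn fdu01 S := by rw [hfdu01]; exact (EuclideanSpace.proj (0 : Fin 3)).continuous.comp_continuousOn ((cdu0 1).comp continuousOn_fst hfst)
  obtain ⟨fdu02, hfdu02⟩ : ∃ f : (ℝ × T3) × (ℝ × V3 × ℝ) → ℝ, f = fun p => Torus.partialDeriv 2 (u p.1.1) p.1.2 0 := ⟨_, rfl⟩
  have cfdu02 : ContinuousOn fdu02 S := by rw [hfdu02]; exact (EuclideanSpace.proj (0 : Fin 3)).continuous.comp_continuousOn ((cdu0 2).comp continuousOn_fst hfst)
  obtain ⟨fdu10, hfdu10⟩ : ∃ f : (ℝ × T3) × (ℝ × V3 × ℝ) → ℝ, f = fun p => Torus.partialDeriv 0 (u p.1.1) p.1.2 1 := ⟨_, rfl⟩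
  have cfdu10 : ContinuousOn fdu10 S := by rw [hfdu10]; exact (EuclideanSpace.proj (1 : Fin 3)).continuous.comp_continuousOn ((cdu0 0).comp continuousOn_fst hfst)
  obtain ⟨fdu11, hfdu11⟩ : ∃ f : (ℝ × T3) × (ℝ × V3 × ℝ) → ℝ, f = fun p => Torus.partialDeriv 1 (u p.1.1) p.1.2 1 := ⟨_, rfl⟩
  have cfdu11 : ContinuousOn fdu11 S := by rw [hfdu11]; exact (EuclideanSpace.proj (1 : Fin 3)).continuous.comp_continuousOn ((cdu0 1).comp continuousOn_fst hfst)
  obtain ⟨fdu12, hfdu12⟩ : ∃ f : (ℝ × T3) × (ℝ × V3 × ℝ) → ℝ, f = fun p => Torus.partialDeriv 2 (u p.1.1) p.1.2 1 := ⟨_, rfl⟩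
  have cfdu12 : ContinuousOn fdu12 S := by rw [hfdu12]; exact (EuclideanSpace.proj (1 : Fin 3)).continuous.comp_continuousOn ((cdu0 2).comp continuousOn_fst hfst)
  obtain ⟨fdu20, hfdu20⟩ : ∃ f : (ℝ × T3) × (ℝ × V3 × ℝ) → ℝ, f = fun p => Torus.partialDeriv 0 (u p.1.1) p.1.2 2 := ⟨_, rfl⟩
  have cfdu20 : ContinuousOn fdu20 S := by rw [hfdu20]; exact (EuclideanSpace.proj (2 : Fin 3)).continuous.comp_continuousOn ((cdu0 0).comp continuousOn_fst hfst)
  obtain ⟨fdu21, hfdu21⟩ : ∃ f : (ℝ × T3) × (ℝ × V3 × ℝ) → ℝ, f = fun p => Torus.partialDeriv 1 (u p.1.1) p.1.2 2 := ⟨_, rfl⟩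
  have cfdu21 : ContinuousOn fdu21 S := by rw [hfdu21]; exact (EuclideanSpace.proj (2 : Fin 3)).continuous.comp_continuousOn ((cdu0 1).comp continuousOn_fst hfst)
  obtain ⟨fdu22, hfdu22⟩ : ∃ f : (ℝ × T3) × (ℝ × V3 × ℝ) → ℝ, f = fun p => Torus.partialDeriv 2 (u p.1.1) p.1.2 2 := ⟨_, rfl⟩
  have cfdu22 : ContinuousOn fdu22 S := by rw [hfdu22]; exact (EuclideanSpace.proj (2 : Fin 3)).continuous.comp_continuousOn ((cdu0 2).comp continuousOn_fst hfst)
  obtain ⟨fF1, hfF1⟩ : ∃ f : (ℝ × T3) × (ℝ × V3 × ℝ) → ℝ, f = fun p => deriv F (ρ p.1.1 p.1.2 * σ ^ 3) := ⟨_, rfl⟩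
  have cfF1 : ContinuousOn fF1 S := by rw [hfF1]; exact hFa.deriv.continuousOn.comp ((cρ0.comp continuousOn_fst hfst).mul continuousOn_const) hmaps
  obtain ⟨fF2, hfF2⟩ : ∃ f : (ℝ × T3) × (ℝ × V3 × ℝ) → ℝ, f = fun p => deriv (deriv F) (ρ p.1.1 p.1.2 * σ ^ 3) := ⟨_, rfl⟩
  have cfF2 : ContinuousOn fF2 S := by rw [hfF2]; exact hFa.deriv.deriv.continuousOn.comp ((cρ0.comp continuousOn_fst hfst).mul continuousOn_const) hmaps
  obtain ⟨fr, hfr⟩ : ∃ f : (ℝ × T3) × (ℝ × V3 × ℝ) → ℝ, f = fun p => p.2.1 := ⟨_, rfl⟩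
  have cfr : ContinuousOn fr S := by rw [hfr]; exact continuousOn_snd.fst
  obtain ⟨fϑ, hfϑ⟩ : ∃ f : (ℝ × T3) × (ℝ × V3 × ℝ) → ℝ, f = fun p => θo p.2 := ⟨_, rfl⟩
  have cfϑ : ContinuousOn fϑ S := by rw [hfϑ]; exact (continuousOn_thetaOf θo hθo hK1).comp continuousOn_snd hsnd
  obtain ⟨fw0, hfw0⟩ : ∃ f : (ℝ × T3) × (ℝ × V3 × ℝ) → ℝ, f = fun p => (p.2.1⁻¹ * p.2.2.1 0) := ⟨_, rfl⟩
  have cfw0 : ContinuousOn fw0 S := by rw [hfw0]; exact (continuousOn_snd.fst.inv₀ hK1').mul ((EuclideanSpace.proj (0 : Fin 3)).continuous.comp_continuousOn continuousOn_snd.snd.fst)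
  obtain ⟨fw1, hfw1⟩ : ∃ f : (ℝ × T3) × (ℝ × V3 × ℝ) → ℝ, f = fun p => (p.2.1⁻¹ * p.2.2.1 1) := ⟨_, rfl⟩
  have cfw1 : ContinuousOn fw1 S := by rw [hfw1]; exact (continuousOn_snd.fst.inv₀ hK1').mul ((EuclideanSpace.proj (1 : Fin 3)).continuous.comp_continuousOn continuousOn_snd.snd.fst)
  obtain ⟨fw2, hfw2⟩ : ∃ f : (ℝ × T3) × (ℝ × V3 × ℝ) → ℝ, f = fun p => (p.2.1⁻¹ * p.2.2.1 2) := ⟨_, rfl⟩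
  have cfw2 : ContinuousOn fw2 S := by rw [hfw2]; exact (continuousOn_snd.fst.inv₀ hK1').mul ((EuclideanSpace.proj (2 : Fin 3)).continuous.comp_continuousOn continuousOn_snd.snd.fst)
  -- the coefficient function
  have hG : ContinuousOn (fun p : (ℝ × T3) × (ℝ × V3 × ℝ) =>
      |fF1 p * fdu00 p * fρ p * σ ^ (3 : ℕ) * fθ p ^ (2 : ℕ) + fF1 p * fdu11 p * fρ p * σ ^ (3 : ℕ) * fθ p ^ (2 : ℕ) + fF1 p * fdu22 p * fρ p * σ ^ (3 : ℕ) * fθ p ^ (2 : ℕ) + fF2 p * fdu00 p * fρ p ^ (2 : ℕ) * σ ^ (6 : ℕ) * fθ p ^ (2 : ℕ) + fF2 p * fdu11 p * fρ p ^ (2 : ℕ) * σ ^ (6 : ℕ) * fθ p ^ (2 : ℕ) + fF2 p * fdu22 p * fρ p ^ (2 : ℕ) * σ ^ (6 : ℕ) * fθ p ^ (2 : ℕ) + fF1 p * (fw0 p - fu0 p) * (fϑ p - fθ p) * fdθ0 p * fρ p * σ ^ (3 : ℕ) + fF1 p * (fw0 p - fu0 p) * fdθ0 p * fρ p * σ ^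 (3 : ℕ) * fθ p + fF1 p * (fw1 p - fu1 p) * (fϑ p - fθ p) * fdθ1 p * fρ p * σ ^ (3 : ℕ) + fF1 p * (fw1 p - fu1 p) * fdθ1 p * fρ p * σ ^ (3 : ℕ) * fθ p + fF1 p * (fw2 p - fu2 p) * (fϑ p - fθ p) * fdθ2 p * fρ p * σ ^ (3 : ℕ) + fF1 p * (fw2 p - fu2 p) * fdθ2 p * fρ p * σ ^ (3 : ℕ) * fθ p + fF1 p * (fϑ p - fθ p) * fdu00 p * fρ p * σ ^ (3 : ℕ) * fθ p + fF1 p * (fϑ p - fθ p) * fdu11 p * fρ p * σ ^ (3 : ℕ) * fθ p + fF1 p * (fϑ p - fθ p) * fdu22 p * fρ p * σ ^ (3 : ℕ) * fθ p + fF2 p * (fw0 p - fu0 p) * (fϑ p - fθ p) * fdθ0 p * fρ p ^ (2 : ℕ) * σ ^ (6 : ℕ) + fF2 p * (fw0 p - fu0 p) * fdθ0 p * fρ p ^ (2 : ℕ) * σ ^ (6 : ℕ) * fθ p + fF2 p * (fw1 p - fu1 p) * (fϑ p - fθ p) * fdθ1 p * fρ p ^ (2 : ℕ) * σ ^ (6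 : ℕ) + fF2 p * (fw1 p - fu1 p) * fdθ1 p * fρ p ^ (2 : ℕ) * σ ^ (6 : ℕ) * fθ p + fF2 p * (fw2 p - fu2 p) * (fϑ p - fθ p) * fdθ2 p * fρ p ^ (2 : ℕ) * σ ^ (6 : ℕ) + fF2 p * (fw2 p - fu2 p) * fdθ2 p * fρ p ^ (2 : ℕ) * σ ^ (6 : ℕ) * fθ p + fF2 p * (fϑ p - fθ p) * fdu00 p * fρ p ^ (2 : ℕ) * σ ^ (6 : ℕ) * fθ p + fF2 p * (fϑ p - fθ p) * fdu11 p * fρ p ^ (2 : ℕ) * σ ^ (6 : ℕ) * fθ p + fF2 p * (fϑ p - fθ p) * fdu22 p * fρ p ^ (2 : ℕ) * σ ^ (6 : ℕ) * fθ p| +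
      |1 / 2 * (fw0 p - fu0 p) ^ (2 : ℕ) * fdθ0 p * fρ p + 1 / 2 * (fw1 p - fu1 p) ^ (2 : ℕ) * fdθ0 p * fρ p + 1 / 2 * (fw2 p - fu2 p) ^ (2 : ℕ) * fdθ0 p * fρ p + 5 / 2 * (fϑ p - fθ p) * fdθ0 p * fρ p + 1 / 2 * (fw0 p - fu0 p) * (fw1 p - fu1 p) * fdθ1 p * fρ p + 1 / 2 * (fw0 p - fu0 p) * (fw2 p - fu2 p) * fdθ2 p * fρ p + 2 / 3 * (fw0 p - fu0 p) * fdu00 p * fρ p * fθ p - 1 / 3 * (fw0 p - fu0 p) * fdu11 p * fρ p * fθ p - 1 / 3 * (fw0 p - fu0 p) * fdu22 p * fρ p * fθ p + (fw1 p - fu1 p) * fdu01 p * fρ p * fθ p + (fw1 p - fu1 p) * fdu10 p * fρ p * fθ p + (fw2 p - fu2 p) * fdu02 p * fρ p * fθ p + (fw2 p - fu2 p) * fdu20 p * fρ p * fθ p + 2 * fF1 p * (fϑ p - fθ p) * fdθ0 p * fρ p ^ (2 : ℕ) * σ ^ (3 : ℕ) + fF1 p * fdθ0 p * fρ p ^ (2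 : ℕ) * σ ^ (3 : ℕ) * fθ p + fF2 p * (fϑ p - fθ p) * fdθ0 p * fρ p ^ (3 : ℕ) * σ ^ (6 : ℕ) + fF2 p * fdθ0 p * fρ p ^ (3 : ℕ) * σ ^ (6 : ℕ) * fθ p - 1 / 3 * fF1 p * (fw0 p - fu0 p) * fdu00 p * fρ p ^ (2 : ℕ) * σ ^ (3 : ℕ) * fθ p - 1 / 3 * fF1 p * (fw0 p - fu0 p) * fdu11 p * fρ p ^ (2 : ℕ) * σ ^ (3 : ℕ) * fθ p - 1 / 3 * fF1 p * (fw0 p - fu0 p) * fdu22 p * fρ p ^ (2 : ℕ) * σ ^ (3 : ℕ) * fθ p| +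
      |1 / 2 * (fw1 p - fu1 p) ^ (2 : ℕ) * fdθ1 p * fρ p + 1 / 2 * (fw2 p - fu2 p) ^ (2 : ℕ) * fdθ1 p * fρ p + 5 / 2 * (fϑ p - fθ p) * fdθ1 p * fρ p + 1 / 2 * (fw1 p - fu1 p) * (fw2 p - fu2 p) * fdθ2 p * fρ p - 1 / 3 * (fw1 p - fu1 p) * fdu00 p * fρ p * fθ p + 2 / 3 * (fw1 p - fu1 p) * fdu11 p * fρ p * fθ p - 1 / 3 * (fw1 p - fu1 p) * fdu22 p * fρ p * fθ p + (fw2 p - fu2 p) * fdu12 p * fρ p * fθ p + (fw2 p - fu2 p) * fdu21 p * fρ p * fθ p + 2 * fF1 p * (fϑ p - fθ p) * fdθ1 p * fρ p ^ (2 : ℕ) * σ ^ (3 : ℕ) + fF1 p * fdθ1 p * fρ p ^ (2 : ℕ) * σ ^ (3 : ℕ) * fθ p + fF2 p * (fϑ p - fθ p) * fdθ1 p * fρ p ^ (3 : ℕ) * σ ^ (6 : ℕ) + fF2 p * fdθ1 p * fρ p ^ (3 : ℕ) * σ ^ (6 : ℕ) * fθ p - 1 / 3 * fF1 p * (fw1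 p - fu1 p) * fdu00 p * fρ p ^ (2 : ℕ) * σ ^ (3 : ℕ) * fθ p - 1 / 3 * fF1 p * (fw1 p - fu1 p) * fdu11 p * fρ p ^ (2 : ℕ) * σ ^ (3 : ℕ) * fθ p - 1 / 3 * fF1 p * (fw1 p - fu1 p) * fdu22 p * fρ p ^ (2 : ℕ) * σ ^ (3 : ℕ) * fθ p| +
      |1 / 2 * (fw2 p - fu2 p) ^ (2 : ℕ) * fdθ2 p * fρ p + 5 / 2 * (fϑ p - fθ p) * fdθ2 p * fρ p - 1 / 3 * (fw2 p - fu2 p) * fdu00 p * fρ p * fθ p - 1 / 3 * (fw2 p - fu2 p) * fdu11 p * fρ p * fθ p + 2 / 3 * (fw2 p - fu2 p) * fdu22 p * fρ p * fθ p + 2 * fF1 p * (fϑ p - fθ p) * fdθ2 p * fρ p ^ (2 : ℕ) * σ ^ (3 : ℕ) + fF1 p * fdθ2 p * fρ p ^ (2 : ℕ) * σ ^ (3 : ℕ) * fθ p + fF2 p * (fϑ p - fθ p) * fdθ2 p * fρ p ^ (3 : ℕ) * σ ^ (6 : ℕ) + fF2 p * fdθ2 p * fρ p ^ (3 : ℕ)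 * σ ^ (6 : ℕ) * fθ p - 1 / 3 * fF1 p * (fw2 p - fu2 p) * fdu00 p * fρ p ^ (2 : ℕ) * σ ^ (3 : ℕ) * fθ p - 1 / 3 * fF1 p * (fw2 p - fu2 p) * fdu11 p * fρ p ^ (2 : ℕ) * σ ^ (3 : ℕ) * fθ p - 1 / 3 * fF1 p * (fw2 p - fu2 p) * fdu22 p * fρ p ^ (2 : ℕ) * σ ^ (3 : ℕ) * fθ p| +
      |fF1 p * fdu00 p * fρ p ^ (2 : ℕ) * σ ^ (3 : ℕ) * fθ p + fF1 p * fdu11 p * fρ p ^ (2 : ℕ) * σ ^ (3 : ℕ) * fθ p + fF1 p * fdu22 p * fρ p ^ (2 : ℕ) * σ ^ (3 : ℕ) * fθ p + fF2 p * fdu00 p * fρ p ^ (3 : ℕ) * σ ^ (6 : ℕ) * fθ p + fF2 p * fdu11 p * fρ p ^ (3 : ℕ) * σ ^ (6 : ℕ) * fθ p + fF2 p * fdu22 p * fρ p ^ (3 : ℕ) * σ ^ (6 : ℕ) * fθ p| +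
      |1 / 2 * (fw0 p - fu0 p) * fdθ0 p * fρ p ^ (2 : ℕ) + 1 / 2 * (fw1 p - fu1 p) * fdθ1 p * fρ p ^ (2 : ℕ) + 1 / 2 * (fw2 p - fu2 p) * fdθ2 p * fρ p ^ (2 : ℕ) + 2 / 3 * fdu00 p * fρ p ^ (2 : ℕ) * fθ p - 1 / 3 * fdu11 p * fρ p ^ (2 : ℕ) * fθ p - 1 / 3 * fdu22 p * fρ p ^ (2 : ℕ) * fθ p - 1 / 3 * fF1 p * fdu00 p * fρ p ^ (3 : ℕ) * σ ^ (3 : ℕ) * fθ p - 1 / 3 * fF1 p * fdu11 p * fρ p ^ (3 : ℕ) * σ ^ (3 : ℕ) * fθ p - 1 / 3 * fF1 p * fdu22 p * fρ p ^ (3 : ℕ) * σ ^ (3 : ℕ) * fθ p| +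
      |1 / 2 * (fw1 p - fu1 p) * fdθ0 p * fρ p ^ (2 : ℕ) + fdu01 p * fρ p ^ (2 : ℕ) * fθ p + fdu10 p * fρ p ^ (2 : ℕ) * fθ p| +
      |1 / 2 * (fw2 p - fu2 p) * fdθ0 p * fρ p ^ (2 : ℕ) + fdu02 p * fρ p ^ (2 : ℕ) * fθ p + fdu20 p * fρ p ^ (2 : ℕ) * fθ p| +
      |5 / 2 * fdθ0 p * fρ p ^ (2 : ℕ) + fF1 p * fdθ0 p * fρ p ^ (3 : ℕ) * σ ^ (3 : ℕ)| +
      |1 / 2 * (fw1 p - fu1 p) * fdθ1 p * fρ p ^ (2 : ℕ) + 1 / 2 * (fw2 p - fu2 p) * fdθ2 p * fρ p ^ (2 : ℕ) - 1 / 3 * fdu00 p * fρ p ^ (2 : ℕ) * fθ p + 2 / 3 * fdu11 p * fρ p ^ (2 : ℕ) * fθ p - 1 / 3 * fdu22 p * fρ p ^ (2 : ℕ) * fθ p - 1 / 3 * fF1 p * fdu00 p * fρ p ^ (3 : ℕ) * σ ^ (3 : ℕ) * fθ p - 1 / 3 * fF1 p * fdu11 p * fρ p ^ (3 : ℕ)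 * σ ^ (3 : ℕ) * fθ p - 1 / 3 * fF1 p * fdu22 p * fρ p ^ (3 : ℕ) * σ ^ (3 : ℕ) * fθ p| +
      |1 / 2 * (fw2 p - fu2 p) * fdθ1 p * fρ p ^ (2 : ℕ) + fdu12 p * fρ p ^ (2 : ℕ) * fθ p + fdu21 p * fρ p ^ (2 : ℕ) * fθ p| +
      |5 / 2 * fdθ1 p * fρ p ^ (2 : ℕ) + fF1 p * fdθ1 p * fρ p ^ (3 : ℕ) * σ ^ (3 : ℕ)| +
      |1 / 2 * (fw2 p - fu2 p) * fdθ2 p * fρ p ^ (2 : ℕ) - 1 / 3 * fdu00 p * fρ p ^ (2 : ℕ) * fθ p - 1 / 3 * fdu11 p * fρ p ^ (2 : ℕ) * fθ p + 2 / 3 * fdu22 p * fρ p ^ (2 : ℕ) * fθ p - 1 / 3 * fF1 p * fdu00 p * fρ p ^ (3 : ℕ) * σ ^ (3 : ℕ) * fθ p - 1 / 3 * fF1 p * fdu11 p * fρ p ^ (3 : ℕ) * σ ^ (3 : ℕ) * fθ p - 1 / 3 * fF1 p * fdu22 p * fρ p ^ (3 : ℕ) * σ ^ (3 : ℕ) *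 fθ p| +
      |5 / 2 * fdθ2 p * fρ p ^ (2 : ℕ) + fF1 p * fdθ2 p * fρ p ^ (3 : ℕ) * σ ^ (3 : ℕ)| +
      |fdu00 p * fρ p ^ (2 : ℕ) * fθ p ^ (2 : ℕ) + fdu11 p * fρ p ^ (2 : ℕ) * fθ p ^ (2 : ℕ) + fdu22 p * fρ p ^ (2 : ℕ) * fθ p ^ (2 : ℕ) + (fr p - fρ p) * fdu00 p * fρ p * fθ p ^ (2 : ℕ) + (fr p - fρ p) * fdu11 p * fρ p * fθ p ^ (2 : ℕ) + (fr p - fρ p) * fdu22 p * fρ p * fθ p ^ (2 : ℕ) + (fw0 p - fu0 p) * (fϑ p - fθ p) * fdθ0 p * fρ p ^ (2 : ℕ) + (fw0 p - fu0 p) * fdθ0 p * fρ p ^ (2 : ℕ) * fθ p + (fw1 p - fu1 p) * (fϑ p - fθ p) * fdθ1 p * fρ p ^ (2 : ℕ) + (fw1 p - fu1 p) * fdθ1 p * fρ p ^ (2 : ℕ) * fθ p + (fw2 p - fu2 p) * (fϑ p - fθ p) * fdθ2 p * fρ p ^ (2 : ℕ) + (fw2 p - fu2 p) * fdθ2 p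 * fρ p ^ (2 : ℕ) * fθ p + (fϑ p - fθ p) * fdu00 p * fρ p ^ (2 : ℕ) * fθ p + (fϑ p - fθ p) * fdu11 p * fρ p ^ (2 : ℕ) * fθ p + (fϑ p - fθ p) * fdu22 p * fρ p ^ (2 : ℕ) * fθ p + (fr p - fρ p) * (fw0 p - fu0 p) * (fϑ p - fθ p) * fdθ0 p * fρ p + (fr p - fρ p) * (fw0 p - fu0 p) * fdθ0 p * fρ p * fθ p + (fr p - fρ p) * (fw1 p - fu1 p) * (fϑ p - fθ p) * fdθ1 p * fρ p + (fr p - fρ p) * (fw1 p - fu1 p) * fdθ1 p * fρ p * fθ p + (fr p - fρ p) * (fw2 p - fu2 p) * (fϑ p - fθ p) * fdθ2 p * fρ p + (fr p - fρ p) * (fw2 p - fu2 p) * fdθ2 p * fρ p * fθ p + (fr p - fρ p) * (fϑ p - fθ p) * fdu00 p * fρ p * fθ p + (fr p - fρ p) * (fϑ p - fθ p) * fdu11 p * fρ p * fθ p + (fr p - fρ p) * (fϑ p - fθ p) * fdu22 p * fρ p * fθ p|) S := by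
    fun_prop
  obtain ⟨B, hB⟩ := hScpt.exists_bound_of_continuousOn hG
  refine ⟨max B 0, le_max_right _ _, fun τ hτ x V hV => ?_⟩
  have h := hB ((τ, x), V) ⟨⟨hτ, mem_univ _⟩, hV⟩
  rw [Real.norm_eq_abs, abs_le] at h
  subst hfρ hfθ hfu0 hfu1 hfu2 hfdθ0 hfdθ1 hfdθ2 hfdu00 hfdu01 hfdu02 hfdu10 hfdu11 hfdu12 hfdu20 hfdu21 hfdu22 hfF1 hfF2 hfr hfϑ hfw0 hfw1 hfw2
  exact h.2.trans (le_max_left _ _)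

/-- **The relative flux is dominated by the relative entropy density** on `[0, t] × 𝕋³ × K`:
the pointwise hypothesis `hquad` of the abstract Dafermos shell for the hard-sphere Euler
system. -/
theorem relFlux_bound (hE : IsHardSphereEulerSolution σ T ρ u θ) (hσ : 0 < σ)
    (hFa : AnalyticOnNhd ℝ F (Ioo (-η₀) η₀)) (hF : EqOn hsExcessFreeEnergy F (Ico 0 η₀))
    (hconv : ∀ η ∈ Ico 0 η₀, 0 ≤ 2 * deriv F η + η * deriv (deriv F) η)
    (hpack : ∀ t ∈ Ico 0 T, ∀ x, ρ t x * σ ^ 3 < η₀)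
    (θo : (ℝ × V3 × ℝ) → ℝ)
    (hθo : θo = fun U => 2 / 3 * (U.2.2 / U.1 - ‖U.2.1‖ ^ 2 / (2 * U.1 ^ 2)))
    (h : (ℝ × V3 × ℝ) → ℝ)
    (hh : h = fun U => -(U.1 * (3 / 2 * Real.log (θo U) - Real.log U.1 -
      hsExcessFreeEnergy (U.1 * σ ^ 3))))
    (flux : Fin 3 → (ℝ × V3 × ℝ) → (ℝ × V3 × ℝ))
    (hflux : flux = fun i U => (U.2.1 i, (U.2.1 i / U.1) • U.2.1 +
      hsPressure σ U.1 (θo U) • EuclideanSpace.single i (1 : ℝ),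
      (U.2.2 + hsPressure σ U.1 (θo U)) * U.2.1 i / U.1))
    (pair : (ℝ × V3 × ℝ) → (ℝ × V3 × ℝ) → ℝ)
    (hpair : pair = fun L U => L.1 * U.1 + (∑ j, L.2.1 j * U.2.1 j) + L.2.2 * U.2.2)
    {t : ℝ} (ht : t ∈ Ico 0 T) {K : Set (ℝ × V3 × ℝ)} (hK : IsCompact K)
    (hKΩ : K ⊆ {U : ℝ × V3 × ℝ | 0 < U.1 ∧ U.1 * σ ^ 3 < η₀ ∧ ‖U.2.1‖ ^ 2 < 2 * U.1 * U.2.2}) :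
    ∃ C₁, 0 ≤ C₁ ∧ ∀ τ ∈ Icc 0 t, ∀ x, ∀ V ∈ K,
      |pair (Torus.timeDerivWithin (Ico 0 T)
        (fun s y => ((-(3 / 2 * Real.log (θ s y) - Real.log (ρ s y) -
        hsExcessFreeEnergy (ρ s y * σ ^ 3)) + 5 / 2 - ‖u s y‖ ^ 2 / (2 * θ s y) +
        ρ s y * σ ^ 3 * deriv hsExcessFreeEnergy (ρ s y * σ ^ 3) : ℝ),
        (θ s y)⁻¹ • u s y, -(θ s y)⁻¹)) τ x) (V - (ρ τ x, ρ τ x • u τ x, totalEnergyDensity (ρ τ x) (u τ x) (θ τ x))) +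
        ∑ i, pair (Torus.partialDeriv i
        (fun y => ((-(3 / 2 * Real.log (θ τ y) - Real.log (ρ τ y) -
        hsExcessFreeEnergy (ρ τ y * σ ^ 3)) + 5 / 2 - ‖u τ y‖ ^ 2 / (2 * θ τ y) +
        ρ τ y * σ ^ 3 * deriv hsExcessFreeEnergy (ρ τ y * σ ^ 3) : ℝ),
        (θ τ y)⁻¹ • u τ y, -(θ τ y)⁻¹)) x) (flux i V - flux i (ρ τ x, ρ τ x • u τ x, totalEnergyDensity (ρ τ x) (u τ x) (θ τ x)))| ≤
      C₁ * (h V - h (ρ τ x, ρ τ x • u τ x, totalEnergyDensity (ρ τ x) (u τ x) (θ τ x)) -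
        pair ((-(3 / 2 * Real.log (θ τ x) - Real.log (ρ τ x) - hsExcessFreeEnergy (ρ τ x * σ ^ 3)) +
            5 / 2 - ‖u τ x‖ ^ 2 / (2 * θ τ x) +
            ρ τ x * σ ^ 3 * deriv hsExcessFreeEnergy (ρ τ x * σ ^ 3) : ℝ),
            (θ τ x)⁻¹ • u τ x, -(θ τ x)⁻¹)
          (V - (ρ τ x, ρ τ x • u τ x, totalEnergyDensity (ρ τ x) (u τ x) (θ τ x)))) := by
  have htT : Icc 0 t ⊆ Ico 0 T := Icc_subset_Ico_right ht.2
  obtain ⟨c₀, hc₀, C', -, hcoer⟩ := coercive_constants hE hσ hFa hF hconv hpack θo hθo h hh pair hpair ht hK hKΩ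
  obtain ⟨B, hB0, hB⟩ := coeff_bound hE hσ hFa hpack θo hθo ht hK hKΩ
  obtain ⟨CR, hCR0, hCR⟩ := remainder_bound hE hσ hFa hF hpack ht hK hKΩ
  obtain ⟨ρmin, hρmin0, hρmin⟩ := HsEulerCalc.exists_pos_le_of_isSmoothSpaceTimeOn hE.smooth_density
    hE.density_pos ht.2
  obtain ⟨θmin, hθmin0, hθmin⟩ := HsEulerCalc.exists_pos_le_of_isSmoothSpaceTimeOn hE.smooth_temperature
    hE.temperature_pos ht.2
  refine ⟨B * (1 + CR) / c₀ / (θmin ^ 2 * ρmin), by positivity, fun τ hτ x V hV => ?_⟩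
  have hτT : τ ∈ Ico 0 T := htT hτ
  have hV1 : 0 < V.1 := (hKΩ hV).1
  have hρ0 := hE.density_pos τ hτT x
  have hθ0 := hE.temperature_pos τ hτT x
  have hpos : 0 < θ τ x ^ 2 * ρ τ x := by positivity
  have hid := relFlux_scaled_eq hE hσ hFa hF hpack θo hθo flux hflux pair hpair hτT x hV1
  have hQ := absorb_quadratic' (b0 := V.1⁻¹ * V.2.1 0 - u τ x 0) (b1 := V.1⁻¹ * V.2.1 1 - u τ x 1)
    (b2 := V.1⁻¹ * V.2.1 2 - u τ x 2) (c := θo V - θ τ x) hCR0 (hB τ hτ x V hV) (hCR τ hτ x V hV)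
  rw [← hid] at hQ
  -- the sum of squared increments is dominated by the relative entropy density
  have hco := (hcoer τ hτ x V hV).1
  have hns : ‖V.1⁻¹ • V.2.1 - u τ x‖ ^ 2 = (V.1⁻¹ * V.2.1 0 - u τ x 0) ^ 2 +
      (V.1⁻¹ * V.2.1 1 - u τ x 1) ^ 2 + (V.1⁻¹ * V.2.1 2 - u τ x 2) ^ 2 := by
    rw [EuclideanSpace.norm_sq_eq]
    simp only [PiLp.sub_apply, PiLp.smul_apply, smul_eq_mul, Real.norm_eq_abs, sq_abs, Fin.sum_univ_three]
  rw [hns] at hco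
  set Hrel := h V - h (ρ τ x, ρ τ x • u τ x, totalEnergyDensity (ρ τ x) (u τ x) (θ τ x)) -
        pair ((-(3 / 2 * Real.log (θ τ x) - Real.log (ρ τ x) - hsExcessFreeEnergy (ρ τ x * σ ^ 3)) +
            5 / 2 - ‖u τ x‖ ^ 2 / (2 * θ τ x) +
            ρ τ x * σ ^ 3 * deriv hsExcessFreeEnergy (ρ τ x * σ ^ 3) : ℝ),
            (θ τ x)⁻¹ • u τ x, -(θ τ x)⁻¹)
          (V - (ρ τ x, ρ τ x • u τ x, totalEnergyDensity (ρ τ x) (u τ x) (θ τ x))) with hHrel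
  have hsq : ((V.1 - ρ τ x) ^ (2 : ℕ) + ((V.1⁻¹ * V.2.1 0) - u τ x 0) ^ (2 : ℕ) + ((V.1⁻¹ * V.2.1 1) - u τ x 1) ^ (2 : ℕ) + ((V.1⁻¹ * V.2.1 2) - u τ x 2) ^ (2 : ℕ) + (θo V - θ τ x) ^ (2 : ℕ)) ≤ Hrel / c₀ := by
    rw [le_div_iff₀ hc₀]
    linarith
  have hHrel0 : 0 ≤ Hrel := by
    have : 0 ≤ ((V.1 - ρ τ x) ^ (2 : ℕ) + ((V.1⁻¹ * V.2.1 0) - u τ x 0) ^ (2 : ℕ) + ((V.1⁻¹ * V.2.1 1) - u τ x 1) ^ (2 : ℕ) + ((V.1⁻¹ * V.2.1 2) - u τ x 2) ^ (2 : ℕ) + (θo V - θ τ x) ^ (2 : ℕ)) := by positivity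
    have h2 := this.trans hsq
    rwa [le_div_iff₀ hc₀, zero_mul] at h2
  -- chain
  set Ψ := pair (Torus.timeDerivWithin (Ico 0 T)
        (fun s y => ((-(3 / 2 * Real.log (θ s y) - Real.log (ρ s y) -
        hsExcessFreeEnergy (ρ s y * σ ^ 3)) + 5 / 2 - ‖u s y‖ ^ 2 / (2 * θ s y) +
        ρ s y * σ ^ 3 * deriv hsExcessFreeEnergy (ρ s y * σ ^ 3) : ℝ),
        (θ s y)⁻¹ • u s y, -(θ s y)⁻¹)) τ x) (V - (ρ τ x, ρ τ x • u τ x, totalEnergyDensity (ρ τ x) (u τ x) (θ τ x))) +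
        ∑ i, pair (Torus.partialDeriv i
        (fun y => ((-(3 / 2 * Real.log (θ τ y) - Real.log (ρ τ y) -
        hsExcessFreeEnergy (ρ τ y * σ ^ 3)) + 5 / 2 - ‖u τ y‖ ^ 2 / (2 * θ τ y) +
        ρ τ y * σ ^ 3 * deriv hsExcessFreeEnergy (ρ τ y * σ ^ 3) : ℝ),
        (θ τ y)⁻¹ • u τ y, -(θ τ y)⁻¹)) x) (flux i V - flux i (ρ τ x, ρ τ x • u τ x, totalEnergyDensity (ρ τ x) (u τ x) (θ τ x))) with hΨ
  have h1 : θ τ x ^ 2 * ρ τ x * |Ψ| ≤ B * (1 + CR) / c₀ * Hrel := by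
    rw [← abs_of_pos hpos, ← abs_mul]
    refine hQ.trans ?_
    calc B * (1 + CR) * ((V.1 - ρ τ x) ^ (2 : ℕ) + ((V.1⁻¹ * V.2.1 0) - u τ x 0) ^ (2 : ℕ) + ((V.1⁻¹ * V.2.1 1) - u τ x 1) ^ (2 : ℕ) + ((V.1⁻¹ * V.2.1 2) - u τ x 2) ^ (2 : ℕ) + (θo V - θ τ x) ^ (2 : ℕ))
        ≤ B * (1 + CR) * (Hrel / c₀) := mul_le_mul_of_nonneg_left hsq (by positivity)
      _ = B * (1 + CR) / c₀ * Hrel := by ring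
  have h2 : |Ψ| ≤ B * (1 + CR) / c₀ * Hrel / (θ τ x ^ 2 * ρ τ x) := by
    rw [le_div_iff₀ hpos, mul_comm]
    exact h1
  refine h2.trans ?_
  have hden : θmin ^ 2 * ρmin ≤ θ τ x ^ 2 * ρ τ x := by
    have hθ' := hθmin τ hτ x
    have hρ' := hρmin τ hτ x
    have : θmin ^ 2 ≤ θ τ x ^ 2 := pow_le_pow_left₀ hθmin0.le hθ' 2
    exact mul_le_mul this hρ' hρmin0.le (by positivity)
  calc B * (1 + CR) / c₀ * Hrel / (θ τ x ^ 2 * ρ τ x)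
      ≤ B * (1 + CR) / c₀ * Hrel / (θmin ^ 2 * ρmin) :=
        div_le_div_of_nonneg_left (by positivity) (by positivity) hden
    _ = B * (1 + CR) / c₀ / (θmin ^ 2 * ρmin) * Hrel := by ring

end Solution

/-! ### The theorem -/

/-- **`EntropicWeakStrongHS` holds**: Dafermos' relative-entropy stability of classical
hard-sphere Euler solutions within measurable fields satisfying only the global entropy
inequality and a small weak-form residual (a-priori form), closing item
stmt-AtomisticToContinuum-13461 of route `JaynesSqueeze`. -/
theorem entropicWeakStrongHS_proof :
    Summit.AtomisticToContinuum.HydrodynamicLimit.Theses.JaynesSqueeze.EntropicWeakStrongHS := by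
  intro hEos
  obtain ⟨η₀, hη₀, F, hFa, hF, hconv⟩ := eos_setup hEos
  refine ⟨η₀, hη₀, ?_⟩
  intro σ hσ T ρ θ u hsol hpack t ht K hK hKΩ ε hε
  have hU : UniqueDiffOn ℝ (Ico (0 : ℝ) T) := uniqueDiffOn_Ico 0 T
  have htT : Icc 0 t ⊆ Ico 0 T := Icc_subset_Ico_right ht.2
  -- the objects of the statement
  set θo : ℝ × V3 × ℝ → ℝ := fun U => 2 / 3 * (U.2.2 / U.1 - ‖U.2.1‖ ^ 2 / (2 * U.1 ^ 2)) with hθo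
  set hL : ℝ × V3 × ℝ → ℝ := fun U => -(U.1 * (3 / 2 * Real.log (θo U) - Real.log U.1 -
    hsExcessFreeEnergy (U.1 * σ ^ 3))) with hhL
  set Ucl : ℝ → T3 → ℝ × V3 × ℝ := fun s x => (ρ s x, ρ s x • u s x,
    totalEnergyDensity (ρ s x) (u s x) (θ s x)) with hUcl
  set lam : ℝ → T3 → ℝ × V3 × ℝ := fun s x => ((-(3 / 2 * Real.log (θ s x) - Real.log (ρ s x) -
    hsExcessFreeEnergy (ρ s x * σ ^ 3)) + 5 / 2 - ‖u s x‖ ^ 2 / (2 * θ s x) +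
    ρ s x * σ ^ 3 * deriv hsExcessFreeEnergy (ρ s x * σ ^ 3) : ℝ),
    (θ s x)⁻¹ • u s x, -(θ s x)⁻¹) with hlam
  set flux : Fin 3 → ℝ × V3 × ℝ → ℝ × V3 × ℝ := fun i U => (U.2.1 i, (U.2.1 i / U.1) • U.2.1 +
    hsPressure σ U.1 (θo U) • EuclideanSpace.single i (1 : ℝ),
    (U.2.2 + hsPressure σ U.1 (θo U)) * U.2.1 i / U.1) with hflux
  set pair : (ℝ × V3 × ℝ) → (ℝ × V3 × ℝ) → ℝ := fun L U => L.1 * U.1 +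
    (∑ j : Fin 3, L.2.1 j * U.2.1 j) + L.2.2 * U.2.2 with hpair
  -- smoothness of the classical data
  have hlamsm : Torus.IsSmoothSpaceTimeOn (Ico 0 T) lam :=
    isSmoothSpaceTimeOn_entropyVar hsol hσ hFa hF hpack
  have hUsm : Torus.IsSmoothSpaceTimeOn (Ico 0 T) Ucl := isSmoothSpaceTimeOn_consVar hsol
  have hslab : Icc (0:ℝ) t ×ˢ (univ : Set T3) ⊆ Ico 0 T ×ˢ univ := prod_mono htT subset_rfl
  -- constants
  obtain ⟨c₀, hc₀, C', hC', hcoer⟩ := coercive_constants hsol hσ hFa hF hconv hpack θo hθo hL hhL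
    pair hpair ht hK hKΩ
  obtain ⟨C₁, hC₁, hquad⟩ := relFlux_bound hsol hσ hFa hF hconv hpack θo hθo hL hhL flux hflux
    pair hpair ht hK hKΩ
  -- the pointwise hypotheses of the shell
  have hnonneg : ∀ τ ∈ Icc 0 t, ∀ x, ∀ V ∈ K, 0 ≤ hL V - hL (Ucl τ x) - pair (lam τ x) (V - Ucl τ x) := by
    intro τ hτ x V hV
    have h1 := (hcoer τ hτ x V hV).1
    have h0 : 0 ≤ c₀ * ((V.1 - ρ τ x) ^ 2 + ‖V.1⁻¹ • V.2.1 - u τ x‖ ^ 2 + (θo V - θ τ x) ^ 2) := by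
      positivity
    exact h0.trans h1
  have hcoer' : ∀ τ ∈ Icc 0 t, ∀ x, ∀ V ∈ K,
      (V.1 - (Ucl τ x).1) ^ 2 + ‖V.2.1 - (Ucl τ x).2.1‖ ^ 2 + (V.2.2 - (Ucl τ x).2.2) ^ 2 ≤
        C' / c₀ * (hL V - hL (Ucl τ x) - pair (lam τ x) (V - Ucl τ x)) := by
    intro τ hτ x V hV
    obtain ⟨h1, h2⟩ := hcoer τ hτ x V hV
    refine h2.trans ?_
    rw [div_mul_eq_mul_div, le_div_iff₀ hc₀]
    calc C' * ((V.1 - ρ τ x) ^ 2 + ‖V.1⁻¹ • V.2.1 - u τ x‖ ^ 2 + (θo V - θ τ x) ^ 2) * c₀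
        = C' * (c₀ * ((V.1 - ρ τ x) ^ 2 + ‖V.1⁻¹ • V.2.1 - u τ x‖ ^ 2 + (θo V - θ τ x) ^ 2)) := by ring
      _ ≤ C' * _ := mul_le_mul_of_nonneg_left h1 hC'
  -- the shell
  obtain ⟨δ, hδ, hmain⟩ := shell (t := t) ht.1 hK pair hpair (U := Ucl) (lam := lam)
    (Dτ := Torus.timeDerivWithin (Ico 0 T) lam) (D := fun i τ x => Torus.partialDeriv i (lam τ) x)
    (h := hL) (flux := flux) (C₁ := C₁) (C₂ := C' / c₀)
    (hUsm.continuousOn_uncurry.mono hslab)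
    (hlamsm.continuousOn_uncurry.mono hslab)
    ((hlamsm.timeDerivWithin hU).continuousOn_uncurry.mono hslab)
    (fun i => (hlamsm.partialDeriv hU i).continuousOn_uncurry.mono hslab)
    ((isSmoothSpaceTimeOn_entropy_consVar hsol hσ hFa hF hpack θo hθo hL hhL).continuousOn_uncurry.mono hslab)
    (fun i => (isSmoothSpaceTimeOn_flux_consVar hsol hσ hFa hF hpack θo hθo flux hflux i).continuousOn_uncurry.mono hslab)
    (continuousOn_entropy_region hσ hFa hF θo hθo hL hhL hKΩ)
    (fun i => continuousOn_flux_region hσ hFa hF θo hθo flux hflux hKΩ i)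
    (bookkeeping_identity hsol hσ hFa hF hpack θo hθo hL hhL flux hflux pair hpair Ucl hUcl lam hlam ht)
    hC₁ (div_nonneg hC' hc₀.le) hnonneg hquad hcoer' ε hε
  -- conclusion
  refine ⟨δ, hδ, ?_⟩
  intro V hVm hVK
  exact hmain V hVm hVK

end Summit.AtomisticToContinuum.HydrodynamicLimit.Theorems.EntropicWeakStrong

end
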